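import Literature.RingTheory.CompleteLocalRings.CoefficientField
import Mathlib.FieldTheory.Perfect
import Mathlib.RingTheory.LocalRing.ResidueField.Basic
import HarnessLib

/-!
# Coefficient fields in prime characteristic: existence for every complete local ring of
# characteristic `p`, and UNIQUENESS when the residue field is perfect

Topic: `Literature/RingTheory/CompleteLocalRings`. Companion of `CoefficientField.lean` (Cohen's theorem,
Matsumura *Commutative Ring Theory* Thm. 28.3 (ii): an `𝔪`-adically complete equicharacteristic local ring
`(A, 𝔪, K)` has a coefficient field — a ring-homomorphism section `σ : K → A` of the residue map).

* `exists_ringHom_comp_residue_eq_id_of_charP` — the prime-characteristic form: a complete local ring `A`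
  with `CharP A p`, `p` prime, is an `𝔽_p`-algebra, hence has a section `σ : K →+* A`, `residue ∘ σ = id`
  (NO hypothesis on `K`);
* `ringHom_eq_of_comp_residue_eq_id_of_perfectField` — **uniqueness for perfect residue fields**
  (Matsumura, remark after Thm. 28.3 / Cohen 1946 Thm. 10 (b): «if `K` is perfect of characteristic `p`, the
  coefficient field is unique», namely `⋂ₙ A^{pⁿ}`): two sections `σ, τ` agree — for `x ∈ K` and every `n`
  write `x = y^{pⁿ}` (Frobenius is bijective on the perfect field `K`); then
  `σ x − τ x = (σ y − τ y)^{pⁿ} ∈ 𝔪^{pⁿ}` (`σ y − τ y ∈ 𝔪` as both have residue `y`; `(a − b)^{pⁿ} = a^{pⁿ} − b^{pⁿ}`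
  in characteristic `p`), so `σ x − τ x ∈ ⋂ₙ 𝔪ⁿ = 0` (`A` is `𝔪`-adically separated);
* `existsUnique_ringHom_comp_residue_eq_id_of_perfectField` — the two combined: a complete local ring of prime
  characteristic with PERFECT residue field has exactly one coefficient field (section form).

Use (campaign `res-hironaka`, chain W5.2, CHAIN v1.6 §1 (E) / §4: the retraction `Bl_𝔪 Spec S → E` of the
graded format is built over a coefficient field of the complete regular local ring `S`; on the core's terms —
`CharP S p`, `IsAdicComplete (maximalIdeal S) S`, residue field perfect — it exists by the first theorem and is
CANONICAL by the second). Everything is PROVED; no definitions; no Noetherian hypothesis.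

## Sources
* H. Matsumura, *Commutative Ring Theory*, CUP 1986, §28: Thm. 28.3 (ii) and the definition of coefficient
  field, p. 215. [Matsumura1987]
* I. S. Cohen, *On the structure and ideal theory of complete local rings*, Trans. AMS 59 (1946), Thm. 9,
  Thm. 10 (b) (uniqueness of the coefficient field when the residue field is perfect / absolutely algebraic).
-/

noncomputable section

namespace Literature.RingTheory.CompleteLocalRings

universe u

open IsLocalRing

variable (A : Type u) [CommRing A] [IsLocalRing A] [IsAdicComplete (maximalIdeal A) A]

/-! ## Existence in prime characteristic -/

/-- **Cohen's theorem in prime characteristic.** A local ring `A` of prime characteristic `p` which is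
`𝔪`-adically complete has a coefficient field: there is a ring homomorphism `σ : K →+* A` from the residue
field with `residue ∘ σ = id`. (`A` is an algebra over the prime field `𝔽_p = ZMod p`; apply
`exists_ringHom_comp_residue_eq_id`.) No hypothesis on the residue field is needed for existence.
[cite: Matsumura1987, Thm. 28.3 (ii)] -/
theorem exists_ringHom_comp_residue_eq_id_of_charP (p : ℕ) (hp : p.Prime) [CharP A p] :
    ∃ σ : ResidueField A →+* A, ∀ x, residue A (σ x) = x := by
  haveI : Fact p.Prime := ⟨hp⟩
  letI : Algebra (ZMod p) A := ZMod.algebra A p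
  exact exists_ringHom_comp_residue_eq_id A (ZMod p)

/-! ## Uniqueness for perfect residue fields -/

variable {A}

omit [IsAdicComplete (maximalIdeal A) A] in
/-- The residue field of a local ring of prime characteristic `p` has characteristic `p`. [folklore] -/
private theorem charP_residueField_of_charP (p : ℕ) (hp : p.Prime) [CharP A p] : CharP (ResidueField A) p :=
  (CharP.charP_iff_prime_eq_zero hp).mpr (by
    rw [← map_natCast (residue A), CharP.cast_eq_zero, map_zero])

/-- Two sections of the residue map differ by elements of `𝔪`: `σ y − τ y ∈ 𝔪`. [folklore] -/
private theorem sub_mem_maximalIdeal_of_comp_residue_eq_id {A : Type u} [CommRing A] [IsLocalRing A]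
    (σ τ : ResidueField A →+* A) (hσ : ∀ x, residue A (σ x) = x) (hτ : ∀ x, residue A (τ x) = x)
    (y : ResidueField A) : σ y - τ y ∈ maximalIdeal A := by
  rw [← residue_eq_zero_iff, map_sub, hσ, hτ, sub_self]

/-- **Uniqueness of the coefficient field for a perfect residue field** (Cohen; Matsumura §28): if `A` is an
`𝔪`-adically complete (indeed: separated) local ring of prime characteristic `p` whose residue field `K` is
perfect, then any two ring-homomorphism sections `σ, τ : K → A` of the residue map coincide. Proof: for `x ∈ K`
and `n ≥ 0` pick `y` with `y^{pⁿ} = x` (Frobenius is onto); then `σ x − τ x = (σ y − τ y)^{pⁿ} ∈ 𝔪^{pⁿ} ⊆ 𝔪ⁿ`,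
so `σ x − τ x ∈ ⋂ₙ 𝔪ⁿ = 0`. [cite: Matsumura1987, §28 p. 215 and Thm. 28.3] -/
theorem ringHom_eq_of_comp_residue_eq_id_of_perfectField (p : ℕ) (hp : p.Prime) [CharP A p]
    [PerfectField (ResidueField A)] (σ τ : ResidueField A →+* A)
    (hσ : ∀ x, residue A (σ x) = x) (hτ : ∀ x, residue A (τ x) = x) : σ = τ := by
  haveI : Fact p.Prime := ⟨hp⟩
  haveI : CharP (ResidueField A) p := charP_residueField_of_charP p hp
  haveI : PerfectRing (ResidueField A) p := PerfectField.toPerfectRing p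
  refine RingHom.ext fun x => sub_eq_zero.mp ?_
  -- `σ x - τ x ∈ 𝔪 ^ p ^ n` for every `n`
  have key : ∀ n : ℕ, σ x - τ x ∈ maximalIdeal A ^ p ^ n := by
    intro n
    obtain ⟨y, hy⟩ := (bijective_iterateFrobenius (ResidueField A) p n).2 x
    rw [iterateFrobenius_def] at hy
    rw [← hy, map_pow, map_pow, ← sub_pow_char_pow]
    exact Ideal.pow_mem_pow (sub_mem_maximalIdeal_of_comp_residue_eq_id σ τ hσ hτ y) _
  -- `A` is `𝔪`-adically separated
  refine IsHausdorff.haus (IsAdicComplete.toIsHausdorff (I := maximalIdeal A) (M := A)) _ fun n => ?_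
  rw [SModEq.zero]
  have hle : maximalIdeal A ^ p ^ n ≤ maximalIdeal A ^ n :=
    Ideal.pow_le_pow_right (Nat.lt_pow_self hp.one_lt).le
  have hmem : σ x - τ x ∈ maximalIdeal A ^ n := hle (key n)
  simpa only [smul_eq_mul, Ideal.mul_top] using hmem

/-- **Exactly one coefficient field** (section form) for a complete local ring of prime characteristic with
perfect residue field. [cite: Matsumura1987, Thm. 28.3 (ii) and §28 p. 215] -/
theorem existsUnique_ringHom_comp_residue_eq_id_of_perfectField (p : ℕ) (hp : p.Prime) [CharP A p]
    [PerfectField (ResidueField A)] :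
    ∃! σ : ResidueField A →+* A, ∀ x, residue A (σ x) = x := by
  obtain ⟨σ, hσ⟩ := exists_ringHom_comp_residue_eq_id_of_charP A p hp
  exact ⟨σ, hσ, fun τ hτ => ringHom_eq_of_comp_residue_eq_id_of_perfectField p hp τ σ hτ hσ⟩

end Literature.RingTheory.CompleteLocalRings

end
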